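/-
Copyright: the b2b-balaban T⁴-continuum CRUX team, row NE7b OWNER lineage `t4-ne7b-p1` (gen 124). Project licence.
-/
import Summits.QuantumFields.BalabanUV.T4Continuum.Spine.NE7b.SupZdPerturbedResponseLipschitz
import Summits.QuantumFields.BalabanUV.T4Continuum.Spine.NE7b.SupZdPerturbedSolutionLipschitz

/-!
# THE FLUCTUATION COVARIANCE IS LIPSCHITZ IN `K` ON `ℤ^d`: with the objects and constants of (223) (the `H + K` column: `Ψ, Ψ^K, M, N_K`,
# all clauses re-exported) and the Green's-function constants of (224), for every source of block profile `|f(p)| ≤ M_fe^{−μ|blk n p − b₀|₁}`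
# and every bounded solutions `u = Gf`, `u^K = G_Kf`: the fluctuation parts `C_Kf = u^K − Σ″m^K(b″)h^K_{b″}` and `Cf = u − Σ″m(b″)h_{b″}`
# satisfy `|C_Kf(p) − Cf(p)| ≤ C_E·M_f·e^{−ν|blk n p − b₀|₁}` with `C_E` EXPLICIT and LINEAR in `ε` — the last of the three `O(ε)` statements of
# the column (`G_K − G` (224), `h^K − h` (223), `C_K − C` here); (214)∕(223)∕(224) BY NAME (row NE7b, node U5c; [folklore])

Cell `pub-balaban`, sub-cell `t4`, spine estimate NE7b (`T4WeightBudget.RelWeightBound`; the cell's OWN estimate — NOT PRINTED in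
[Bałaban 1983–89], NOT PROVED).  Crux-route work under `Spine/NE7b/` by the row OWNER (`t4-ne7b-p1` gen 124, file (225)) under FREEZE
(0)'s crux-prover clause; NOTHING of Bałaban's is named as a Lean object, valued or asserted; no `T4Continuum/Support` leaf typed; no `def`,
no notation (`m, m^K, h_{b″}, h^K_{b″}, C_E` WRITTEN OUT); zero `sorry`.  TWO constant triples are exposed (the column's `C₀, C_P, δ₀` from
(222)∕(223) and the Green's function's `C₀′, C_P′, δ₀′` from (224), each behind its own `∃` upstream — recorded packaging constraint; both
come from `(d, a, λ, Λ)` only).  Imports (BY NAME): the OWNER's (223) `…SupZdPerturbedResponseLipschitz` (`zd_perturbed_response_lipschitz`),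
(224) `…SupZdPerturbedSolutionLipschitz` (`zd_perturbed_solution_lipschitz`), (222) `K_pos`, (214) `tsum_exp_conv_noLoss`, (191)
`natAbs_sub_comm_sum`, (27) `mem_B`, `sum_B_const`; Mathlib's `Summable.tsum_sub`, `norm_tsum_le_tsum_norm`.

WHY (located).  § [NE7bP1-G124-HANDOFF] NEXT (3)(b) and the ADDENDUM's item (a′): the relative weight bound compares the fluctuation
measures with and without the small nonlocal part; at the level of the linear column that is `C_K − C = O(ε)` with the block-scale decay.
Split: `C_Kf − Cf = (u^K − u) − Σ″[(m^K − m)(b″)h^K_{b″} + m(b″)(h^K_{b″} − h_{b″})]`; (224) bounds `u^K − u` and (by block means) `m^K − m` by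
`4C_P′K_{δ₀′−μ}θ′M_fe^{−μ|·−b₀|₁}` and `m` by `2C_P′K_{δ₀′−μ}M_f`; the response kernels decay like `2C_M′·2C_PK_{δ₀−μ}K_{μ−ν}e^{−ν|blk n p − b″|₁}`
((223)'s `N_K`, `Ψ^K` bounds + (214)), `h` likewise with `c₁` (since `ν < δ₁`), and `|h^K_{b″} − h_{b″}| ≤ LK_{μ−ν}e^{−ν|blk n p − b″|₁}` is (223)
(D); the sum over `b″` is one more no-loss convolution of the rates `ν < μ` ((214)), so the whole difference keeps the rate `ν` and every
term carries a factor `θ, θ′` or `θ_N`, all `∝ ε`.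

WHAT IS PROVED ([folklore]): §1 **`zd_perturbed_covariance_lipschitz`** (THE END: `∃ C₀ C_P δ₀ c₁ δ₁ C₀′ C_P′ δ₀′ > 0`: for ALL `n, V, ε, γ,
μ, ν` with the three + two smallness conditions and every `K` of the class: `∃ Ψ Ψ^K M N` with ALL clauses (A)–(D) of (223) AND (E): for every
profile source and bounded solutions `u, u^K`: summability of both response parts and the bound `C_EM_fe^{−ν|blk n p − b₀|₁}` on
`C_Kf − Cf`); §2 toy.

HONEST (what this is NOT).  Pointwise kernel statements; no operator packaging; `K` enters only through `ε, γ` (no structure used); no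
symmetry of `N_K`, `C_K`; no torus → `ℤ^d` limit of the `H + K` tower — THAT is the remaining infinite-volume item of the column; THREE + TWO
smallness conditions with the sup road's constants — NOT (163)'s energy threshold; the LINEAR column only; `d ≥ 3` only; scalar skeleton
((A3), NC-NE7b-α UNRULED); nothing of the covariant propagators of [B4]–[B6]; nothing of Bałaban's asserted.  BY-NAME EFFECT ON THE WALL:
NONE.  NE7b NOT PRINTED ∕ NOT PROVED; spine PROVED 0∕9; rung (B)+1 — the programme's measures remain FINITE-torus statements; NOT the mass
gap, NOT Clay.  HONEST DEPENDENCY: continuum YM on T⁴ ⇐ BetaPertH ∧ nine spine estimates (0∕9 proved); BetaPertH ⇐ (D1) ∧ (D4) ∧ CAP+tail;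
G-an2-4 gates asym, D1 and NE2∕3∕4.
-/

set_option autoImplicit false

noncomputable section

namespace Summit.QuantumFields.BalabanUV.T4Continuum.NE7b.SupZdPerturbedCovarianceLipschitz

open Real Filter Topology
open scoped ENNReal
open Literature.MathematicalPhysics.QuantumFieldTheory.Balaban1983to89
open B6QGQLower276 (X e blk B mem_B sum_B_const)
open SupZdCoarseForm (natAbs_sub_comm_sum)
open SupZdProfileNoLoss (tsum_exp_conv_noLoss)
open SupZdPerturbedColumn (K_pos)
open SupZdPerturbedResponseLipschitz (zd_perturbed_response_lipschitz)
open SupZdPerturbedSolutionLipschitz (zd_perturbed_solution_lipschitz)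

variable {d : ℕ}

/-! ## §1. THE END: the fluctuation covariance is Lipschitz in `K` -/

/-- **HEADLINE — THE FLUCTUATION COVARIANCE IS LIPSCHITZ IN `K` ON `ℤ^d`**: with the constants and ALL the clauses of (223) (re-exported
verbatim: the column's objects `Ψ, Ψ^K, M, N_K` with equations, decay, `TM = MT = 1`, `T_KN_K = N_KT_K = 1`, `|N_K − M|`, uniqueness, response
Lipschitz) AND the Green's-function constants of (224) (a second triple `C₀′, C_P′, δ₀′` with its two smallness conditions), additionally:
for every source of block profile `|f(p)| ≤ M_fe^{−μ|blk n p − b₀|₁}` and every bounded solutions `u` of `H_Vu = f`, `u^K` of `(H_V + K)u^K = f`,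
the fluctuation parts `C_Kf = u^K − Σ″m^K(b″)h^K_{b″}` and `Cf = u − Σ″m(b″)h_{b″}` (block means `m^K, m`; response kernels `h^K_{b″} =
Σ′N_K(b′,b″)Ψ^K_{b′}`, `h_{b″} = Σ′M(b′,b″)Ψ_{b′}`) satisfy `|C_Kf(p) − Cf(p)| ≤ C_E·M_f·e^{−ν|blk n p − b₀|₁}` with `C_E` explicit and LINEAR
in `ε` — `(u^K − u)` by (224), `Σ″[(m^K − m)h^K + m(h^K − h)]` by (224)'s block means, (223)'s response Lipschitz bound and two no-loss
convolutions ((214)). [folklore] -/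
theorem zd_perturbed_covariance_lipschitz (hd : 3 ≤ d) (a : ℝ) (ha : 0 < a) {lam Lam : ℝ} (hlam : lam < min 2 a) (hLam : 0 ≤ Lam) :
    ∃ C₀ CP δ₀ c₁ δ₁ C₀' CP' δ₀' : ℝ, 0 < C₀ ∧ 0 < CP ∧ 0 < δ₀ ∧ 0 < c₁ ∧ 0 < δ₁ ∧ 0 < C₀' ∧ 0 < CP' ∧ 0 < δ₀' ∧
    ∀ (n : ℕ) (V : X d → ℝ), (∀ p, -lam ≤ V p) → (∀ p, V p ≤ Lam) →
    ∀ (ε γ μ ν : ℝ), 0 ≤ ε → 0 < μ → μ < δ₀ → μ < γ → 0 < ν → ν < μ → ν < δ₁ →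
      ε * (2 * (1 - exp (-γ))⁻¹) ^ d * C₀ ≤ 1 / 2 →
      (CP * (2 * (1 - exp (-(δ₀ - μ)))⁻¹) ^ d) * (ε * exp (μ * d) * (2 * (1 - exp (-(γ - μ)))⁻¹) ^ d) ≤ 1 / 2 →
      (c₁ * exp (ν * d) * (2 * (1 - exp (-(δ₁ - ν)))⁻¹) ^ d)
        * ((4 * (CP * (2 * (1 - exp (-(δ₀ - μ)))⁻¹) ^ d)
            * ((CP * (2 * (1 - exp (-(δ₀ - μ)))⁻¹) ^ d) * (ε * exp (μ * d) * (2 * (1 - exp (-(γ - μ)))⁻¹) ^ d)))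
          * exp (ν * d) * (2 * (1 - exp (-(μ - ν)))⁻¹) ^ d) ≤ 1 / 2 →
      -- the Green's function's constants ((224)): range and two smallness conditions
      μ < δ₀' → ε * (2 * (1 - exp (-γ))⁻¹) ^ d * C₀' ≤ 1 / 2 →
      (CP' * (2 * (1 - exp (-(δ₀' - μ)))⁻¹) ^ d) * (ε * exp (μ * d) * (2 * (1 - exp (-(γ - μ)))⁻¹) ^ d) ≤ 1 / 2 →
    ∀ (K : X d → X d → ℝ), (∀ p q, |K p q| ≤ ε * exp (-(γ * ∑ i, (((p i - q i).natAbs : ℕ) : ℝ)))) →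
    ∃ Ψ ΨK M N : X d → X d → ℝ,
      -- (A) the block columns
      (∀ c p, ((n : ℝ) + 1) ^ 2 * ∑ μ', (2 * Ψ c p - Ψ c (p + e μ') - Ψ c (p - e μ'))
        + a / ((n : ℝ) + 1) ^ d * ∑ q ∈ B n (blk n p), Ψ c q + V p * Ψ c p = if blk n p = c then 1 else 0) ∧
      (∀ c p, |Ψ c p| ≤ 2 * (CP * (2 * (1 - exp (-(δ₀ - μ)))⁻¹) ^ d) * exp (-(μ * ∑ i, (((blk n p i - c i).natAbs : ℕ) : ℝ)))) ∧
      (∀ c p, ((n : ℝ) + 1) ^ 2 * ∑ μ', (2 * ΨK c p - ΨK c (p + e μ') - ΨK c (p - e μ'))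
        + a / ((n : ℝ) + 1) ^ d * ∑ q ∈ B n (blk n p), ΨK c q + V p * ΨK c p + ∑' q : X d, K p q * ΨK c q
          = if blk n p = c then 1 else 0) ∧
      (∀ c p, |ΨK c p| ≤ 2 * (CP * (2 * (1 - exp (-(δ₀ - μ)))⁻¹) ^ d) * exp (-(μ * ∑ i, (((blk n p i - c i).natAbs : ℕ) : ℝ)))) ∧
      (∀ c p, |ΨK c p - Ψ c p| ≤ 4 * (CP * (2 * (1 - exp (-(δ₀ - μ)))⁻¹) ^ d)
        * ((CP * (2 * (1 - exp (-(δ₀ - μ)))⁻¹) ^ d) * (ε * exp (μ * d) * (2 * (1 - exp (-(γ - μ)))⁻¹) ^ d))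
        * exp (-(μ * ∑ i, (((blk n p i - c i).natAbs : ℕ) : ℝ)))) ∧
      (∀ b c, |(((n : ℝ) + 1) ^ d)⁻¹ * ∑ q ∈ B n b, ΨK c q - (((n : ℝ) + 1) ^ d)⁻¹ * ∑ q ∈ B n b, Ψ c q|
        ≤ 4 * (CP * (2 * (1 - exp (-(δ₀ - μ)))⁻¹) ^ d)
          * ((CP * (2 * (1 - exp (-(δ₀ - μ)))⁻¹) ^ d) * (ε * exp (μ * d) * (2 * (1 - exp (-(γ - μ)))⁻¹) ^ d))
          * exp (-(μ * ∑ i, (((b i - c i).natAbs : ℕ) : ℝ)))) ∧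
      -- (B) the inverse of the coarse operator
      (∀ b b' : X d, Tendsto (fun R : ℕ =>
        if h : b ∈ (Fintype.piFinset fun _ : Fin d => Finset.Icc (-(R : ℤ)) R) ∧
            b' ∈ (Fintype.piFinset fun _ : Fin d => Finset.Icc (-(R : ℤ)) R)
          then (Matrix.of fun c c' : ↥(Fintype.piFinset fun _ : Fin d => Finset.Icc (-(R : ℤ)) R) =>
            (((n : ℝ) + 1) ^ d)⁻¹ * ∑ q ∈ B n (c : X d), Ψ (c' : X d) q)⁻¹ ⟨b, h.1⟩ ⟨b', h.2⟩ else 0)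
        atTop (𝓝 (M b b'))) ∧
      (∀ b c, |M b c| ≤ c₁ * exp (-(δ₁ * ∑ i, (((b i - c i).natAbs : ℕ) : ℝ)))) ∧
      (∀ b c, M b c = M c b) ∧
      (∀ b c, ∑' b' : X d, ((((n : ℝ) + 1) ^ d)⁻¹ * ∑ q ∈ B n b, Ψ b' q) * M b' c = if b = c then 1 else 0) ∧
      (∀ b c, ∑' b' : X d, M b b' * ((((n : ℝ) + 1) ^ d)⁻¹ * ∑ q ∈ B n b', Ψ c q) = if b = c then 1 else 0) ∧
      -- (C) the inverse of the perturbed coarse operator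
      (∀ b c, |N b c| ≤ 2 * (c₁ * exp (ν * d) * (2 * (1 - exp (-(δ₁ - ν)))⁻¹) ^ d) * exp (-(ν * ∑ i, (((b i - c i).natAbs : ℕ) : ℝ)))) ∧
      (∀ b c, Summable (fun b' : X d => ((((n : ℝ) + 1) ^ d)⁻¹ * ∑ q ∈ B n b, ΨK b' q) * N b' c) ∧
        ∑' b' : X d, ((((n : ℝ) + 1) ^ d)⁻¹ * ∑ q ∈ B n b, ΨK b' q) * N b' c = if b = c then 1 else 0) ∧
      (∀ b c, Summable (fun b' : X d => N b b' * ((((n : ℝ) + 1) ^ d)⁻¹ * ∑ q ∈ B n b', ΨK c q)) ∧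
        ∑' b' : X d, N b b' * ((((n : ℝ) + 1) ^ d)⁻¹ * ∑ q ∈ B n b', ΨK c q) = if b = c then 1 else 0) ∧
      (∀ b c, |N b c - M b c| ≤ 2 * (c₁ * exp (ν * d) * (2 * (1 - exp (-(δ₁ - ν)))⁻¹) ^ d)
        * ((c₁ * exp (ν * d) * (2 * (1 - exp (-(δ₁ - ν)))⁻¹) ^ d)
          * ((4 * (CP * (2 * (1 - exp (-(δ₀ - μ)))⁻¹) ^ d)
              * ((CP * (2 * (1 - exp (-(δ₀ - μ)))⁻¹) ^ d) * (ε * exp (μ * d) * (2 * (1 - exp (-(γ - μ)))⁻¹) ^ d)))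
            * exp (ν * d) * (2 * (1 - exp (-(μ - ν)))⁻¹) ^ d))
        * exp (-(ν * ∑ i, (((b i - c i).natAbs : ℕ) : ℝ)))) ∧
      (∀ (N' : X d → X d → ℝ) (C' ν' : ℝ), 0 ≤ C' → 0 < ν' →
        (∀ b c, |N' b c| ≤ C' * exp (-(ν' * ∑ i, (((b i - c i).natAbs : ℕ) : ℝ)))) →
        ((∀ b c, ∑' b' : X d, ((((n : ℝ) + 1) ^ d)⁻¹ * ∑ q ∈ B n b, ΨK b' q) * N' b' c = if b = c then 1 else 0) →
          ∀ b c, N' b c = N b c) ∧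
        ((∀ b c, ∑' b' : X d, N' b b' * ((((n : ℝ) + 1) ^ d)⁻¹ * ∑ q ∈ B n b', ΨK c q) = if b = c then 1 else 0) →
          ∀ b c, N' b c = N b c)) ∧
      -- (D) the response kernels are Lipschitz in `K`
      (∀ (b₀ p : X d),
        Summable (fun b' : X d => M b' b₀ * Ψ b' p) ∧ Summable (fun b' : X d => N b' b₀ * ΨK b' p) ∧
        |∑' b' : X d, N b' b₀ * ΨK b' p - ∑' b' : X d, M b' b₀ * Ψ b' p|
          ≤ (2 * (c₁ * exp (ν * d) * (2 * (1 - exp (-(δ₁ - ν)))⁻¹) ^ d)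
                * ((c₁ * exp (ν * d) * (2 * (1 - exp (-(δ₁ - ν)))⁻¹) ^ d)
                  * ((4 * (CP * (2 * (1 - exp (-(δ₀ - μ)))⁻¹) ^ d)
                      * ((CP * (2 * (1 - exp (-(δ₀ - μ)))⁻¹) ^ d) * (ε * exp (μ * d) * (2 * (1 - exp (-(γ - μ)))⁻¹) ^ d)))
                    * exp (ν * d) * (2 * (1 - exp (-(μ - ν)))⁻¹) ^ d))
                * (2 * (CP * (2 * (1 - exp (-(δ₀ - μ)))⁻¹) ^ d))
              + c₁ * (4 * (CP * (2 * (1 - exp (-(δ₀ - μ)))⁻¹) ^ d)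
                * ((CP * (2 * (1 - exp (-(δ₀ - μ)))⁻¹) ^ d) * (ε * exp (μ * d) * (2 * (1 - exp (-(γ - μ)))⁻¹) ^ d))))
            * (2 * (1 - exp (-(μ - ν)))⁻¹) ^ d * exp (-(ν * ∑ i, (((blk n p i - b₀ i).natAbs : ℕ) : ℝ)))) ∧
      -- (E) the fluctuation covariance is Lipschitz in `K`: `|C_Kf − Cf| = O(ε)` on profile sources, with decay
      (∀ (b₀ : X d) (Mf : ℝ) (f : X d → ℝ), (∀ p, |f p| ≤ Mf * exp (-(μ * ∑ i, (((blk n p i - b₀ i).natAbs : ℕ) : ℝ)))) →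
        ∀ (u : X d → ℝ) (Bu : ℝ), (∀ p, |u p| ≤ Bu) →
        (∀ p, ((n : ℝ) + 1) ^ 2 * ∑ μ', (2 * u p - u (p + e μ') - u (p - e μ'))
          + a / ((n : ℝ) + 1) ^ d * ∑ q ∈ B n (blk n p), u q + V p * u p = f p) →
        ∀ (uK : X d → ℝ) (BuK : ℝ), (∀ p, |uK p| ≤ BuK) →
        (∀ p, ((n : ℝ) + 1) ^ 2 * ∑ μ', (2 * uK p - uK (p + e μ') - uK (p - e μ'))
          + a / ((n : ℝ) + 1) ^ d * ∑ q ∈ B n (blk n p), uK q + V p * uK p + ∑' q : X d, K p q * uK q = f p) →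
        ∀ p, (Summable fun b'' : X d =>
            ((((n : ℝ) + 1) ^ d)⁻¹ * ∑ q ∈ B n b'', uK q) * ∑' b' : X d, N b' b'' * ΨK b' p) ∧
          (Summable fun b'' : X d =>
            ((((n : ℝ) + 1) ^ d)⁻¹ * ∑ q ∈ B n b'', u q) * ∑' b' : X d, M b' b'' * Ψ b' p) ∧
          |(uK p - ∑' b'' : X d, ((((n : ℝ) + 1) ^ d)⁻¹ * ∑ q ∈ B n b'', uK q) * ∑' b' : X d, N b' b'' * ΨK b' p)
            - (u p - ∑' b'' : X d, ((((n : ℝ) + 1) ^ d)⁻¹ * ∑ q ∈ B n b'', u q) * ∑' b' : X d, M b' b'' * Ψ b' p)|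
          ≤ (4 * (CP' * (2 * (1 - exp (-(δ₀' - μ)))⁻¹) ^ d)
                * ((CP' * (2 * (1 - exp (-(δ₀' - μ)))⁻¹) ^ d) * (ε * exp (μ * d) * (2 * (1 - exp (-(γ - μ)))⁻¹) ^ d))
              + ((4 * (CP' * (2 * (1 - exp (-(δ₀' - μ)))⁻¹) ^ d)
                  * ((CP' * (2 * (1 - exp (-(δ₀' - μ)))⁻¹) ^ d) * (ε * exp (μ * d) * (2 * (1 - exp (-(γ - μ)))⁻¹) ^ d)))
                  * ((2 * (c₁ * exp (ν * d) * (2 * (1 - exp (-(δ₁ - ν)))⁻¹) ^ d))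
                    * (2 * (CP * (2 * (1 - exp (-(δ₀ - μ)))⁻¹) ^ d)) * (2 * (1 - exp (-(μ - ν)))⁻¹) ^ d)
                + (2 * (CP' * (2 * (1 - exp (-(δ₀' - μ)))⁻¹) ^ d))
                  * ((2 * (c₁ * exp (ν * d) * (2 * (1 - exp (-(δ₁ - ν)))⁻¹) ^ d)
                      * ((c₁ * exp (ν * d) * (2 * (1 - exp (-(δ₁ - ν)))⁻¹) ^ d)
                        * ((4 * (CP * (2 * (1 - exp (-(δ₀ - μ)))⁻¹) ^ d)
                            * ((CP * (2 * (1 - exp (-(δ₀ - μ)))⁻¹) ^ d) * (ε * exp (μ * d) * (2 * (1 - exp (-(γ - μ)))⁻¹) ^ d)))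
                          * exp (ν * d) * (2 * (1 - exp (-(μ - ν)))⁻¹) ^ d))
                      * (2 * (CP * (2 * (1 - exp (-(δ₀ - μ)))⁻¹) ^ d))
                    + c₁ * (4 * (CP * (2 * (1 - exp (-(δ₀ - μ)))⁻¹) ^ d)
                      * ((CP * (2 * (1 - exp (-(δ₀ - μ)))⁻¹) ^ d) * (ε * exp (μ * d) * (2 * (1 - exp (-(γ - μ)))⁻¹) ^ d))))
                    * (2 * (1 - exp (-(μ - ν)))⁻¹) ^ d))
                * (2 * (1 - exp (-(μ - ν)))⁻¹) ^ d)
            * Mf * exp (-(ν * ∑ i, (((blk n p i - b₀ i).natAbs : ℕ) : ℝ)))) := by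
  classical
  obtain ⟨C₀, CP, δ₀, c₁, δ₁, hC₀, hCP, hδ₀, hc₁, hδ₁, H223⟩ := zd_perturbed_response_lipschitz (d := d) hd a ha hlam hLam
  obtain ⟨C₀e, CPe, δ₀e, hC₀e, hCPe, hδ₀e, H224⟩ := zd_perturbed_solution_lipschitz (d := d) hd a ha hlam hLam
  refine ⟨C₀, CP, δ₀, c₁, δ₁, C₀e, CPe, δ₀e, hC₀, hCP, hδ₀, hc₁, hδ₁, hC₀e, hCPe, hδ₀e, ?_⟩
  intro n V hV hV' ε γ μ ν hε hμ hμδ hμγ hν hνμ hνδ hsmall1 hsmall2 hsmall3 hμδe hsmall1e hsmall2e K hK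
  obtain ⟨Ψ, ΨK, M, N, hA1, hA2, hA3, hA4, hA5, hA6, hB1, hB2, hB3, hB4, hB5, hC1, hC2, hC3, hC4, hC5, hD⟩ :=
    H223 n V hV hV' ε γ μ ν hε hμ hμδ hμγ hν hνμ hνδ hsmall1 hsmall2 hsmall3 K hK
  refine ⟨Ψ, ΨK, M, N, hA1, hA2, hA3, hA4, hA5, hA6, hB1, hB2, hB3, hB4, hB5, hC1, hC2, hC3, hC4, hC5, hD,
    fun b₀ Mf f hf u Bu huB hu uK BuK huKB huK p => ?_⟩
  obtain ⟨-, -, H3⟩ := H224 n V hV hV' ε γ μ hε hμ hμδe hμγ hsmall1e hsmall2e K hK b₀ Mf f hf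
  obtain ⟨hud, huKd, hdiff, hmdiff⟩ := H3 u Bu huB hu uK BuK huKB huK
  have hvol : (0 : ℝ) < ((n : ℝ) + 1) ^ d := by positivity
  -- names for the composite constants
  have hK0 : 0 < (2 * (1 - exp (-(δ₀ - μ)))⁻¹) ^ d := K_pos (d := d) (sub_pos.2 hμδ)
  have hK0e : 0 < (2 * (1 - exp (-(δ₀e - μ)))⁻¹) ^ d := K_pos (d := d) (sub_pos.2 hμδe)
  have hK1 : 0 < (2 * (1 - exp (-(δ₁ - ν)))⁻¹) ^ d := K_pos (d := d) (sub_pos.2 hνδ)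
  have hKγμ : 0 < (2 * (1 - exp (-(γ - μ)))⁻¹) ^ d := K_pos (d := d) (sub_pos.2 hμγ)
  have hKv0 : 0 < (2 * (1 - exp (-(μ - ν)))⁻¹) ^ d := K_pos (d := d) (sub_pos.2 hνμ)
  obtain ⟨CPK, hCPK⟩ : ∃ CPK : ℝ, CPK = CP * (2 * (1 - exp (-(δ₀ - μ)))⁻¹) ^ d := ⟨_, rfl⟩
  obtain ⟨CPKe, hCPKe⟩ : ∃ CPKe : ℝ, CPKe = CPe * (2 * (1 - exp (-(δ₀e - μ)))⁻¹) ^ d := ⟨_, rfl⟩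
  obtain ⟨Y, hY⟩ : ∃ Y : ℝ, Y = ε * exp (μ * d) * (2 * (1 - exp (-(γ - μ)))⁻¹) ^ d := ⟨_, rfl⟩
  obtain ⟨CM, hCM⟩ : ∃ CM : ℝ, CM = c₁ * exp (ν * d) * (2 * (1 - exp (-(δ₁ - ν)))⁻¹) ^ d := ⟨_, rfl⟩
  obtain ⟨Kv, hKv⟩ : ∃ Kv : ℝ, Kv = (2 * (1 - exp (-(μ - ν)))⁻¹) ^ d := ⟨_, rfl⟩
  have hCPK0 : 0 ≤ CPK := by rw [hCPK]; positivity
  have hCPKe0 : 0 ≤ CPKe := by rw [hCPKe]; positivity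
  have hY0 : 0 ≤ Y := by rw [hY]; positivity
  have hCM0 : 0 ≤ CM := by rw [hCM]; positivity
  have hKv1 : 0 < Kv := by rw [hKv]; exact hKv0
  rw [← hCPK] at hA2 hA4
  rw [← hCM] at hC1
  rw [← hCPK, ← hY, ← hCM, ← hKv] at hD
  rw [← hCPKe] at hud huKd
  rw [← hCPKe, ← hY] at hdiff hmdiff
  rw [← hCPK, ← hCPKe, ← hY, ← hCM, ← hKv]
  obtain ⟨TN, hTN⟩ : ∃ TN : ℝ, TN = CM * (4 * CPK * (CPK * Y) * exp (ν * d) * Kv) := ⟨_, rfl⟩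
  have hTN0 : 0 ≤ TN := by rw [hTN]; positivity
  rw [← hTN] at hD ⊢
  obtain ⟨L, hL⟩ : ∃ L : ℝ, L = 2 * CM * TN * (2 * CPK) + c₁ * (4 * CPK * (CPK * Y)) := ⟨_, rfl⟩
  have hL0 : 0 ≤ L := by rw [hL]; positivity
  rw [← hL] at hD ⊢
  have hMf : 0 ≤ Mf := by
    have h1 := (abs_nonneg _).trans (hf p)
    exact le_of_mul_le_mul_right (by rw [zero_mul]; exact h1) (exp_pos _)
  -- abbreviations: block means and response kernels
  obtain ⟨mK, hmK⟩ : ∃ mK : X d → ℝ, ∀ b'', mK b'' = (((n : ℝ) + 1) ^ d)⁻¹ * ∑ q ∈ B n b'', uK q := ⟨_, fun _ => rfl⟩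
  obtain ⟨m, hm⟩ : ∃ m : X d → ℝ, ∀ b'', m b'' = (((n : ℝ) + 1) ^ d)⁻¹ * ∑ q ∈ B n b'', u q := ⟨_, fun _ => rfl⟩
  obtain ⟨hrK, hhrK⟩ : ∃ hrK : X d → X d → ℝ, ∀ b'' p, hrK b'' p = ∑' b' : X d, N b' b'' * ΨK b' p := ⟨_, fun _ _ => rfl⟩
  obtain ⟨hr, hhr⟩ : ∃ hr : X d → X d → ℝ, ∀ b'' p, hr b'' p = ∑' b' : X d, M b' b'' * Ψ b' p := ⟨_, fun _ _ => rfl⟩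
  have efold1 : ∀ b'', ((((n : ℝ) + 1) ^ d)⁻¹ * ∑ q ∈ B n b'', uK q) * ∑' b' : X d, N b' b'' * ΨK b' p = mK b'' * hrK b'' p :=
    fun b'' => by rw [hmK, hhrK]
  have efold2 : ∀ b'', ((((n : ℝ) + 1) ^ d)⁻¹ * ∑ q ∈ B n b'', u q) * ∑' b' : X d, M b' b'' * Ψ b' p = m b'' * hr b'' p :=
    fun b'' => by rw [hm, hhr]
  simp only [efold1, efold2]
  -- block means: profiles and the `O(ε)` difference ((224))
  have hmean : ∀ (b : X d) (A : ℝ) (Φ : X d → ℝ), (∀ q, |Φ q| ≤ A * exp (-(μ * ∑ i, (((blk n q i - b₀ i).natAbs : ℕ) : ℝ)))) →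
      |(((n : ℝ) + 1) ^ d)⁻¹ * ∑ q ∈ B n b, Φ q| ≤ A * exp (-(μ * ∑ i, (((b i - b₀ i).natAbs : ℕ) : ℝ))) := by
    intro b A Φ hΦ
    rw [abs_mul, abs_inv, abs_of_pos hvol, inv_mul_le_iff₀ hvol]
    calc |∑ q ∈ B n b, Φ q| ≤ ∑ q ∈ B n b, |Φ q| := Finset.abs_sum_le_sum_abs _ _
      _ ≤ ∑ _q ∈ B n b, A * exp (-(μ * ∑ i, (((b i - b₀ i).natAbs : ℕ) : ℝ))) :=
          Finset.sum_le_sum fun q hq => by have h := hΦ q; rw [mem_B.1 hq] at h; exact h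
      _ = _ := sum_B_const _ _
  have hmKd : ∀ b'', |mK b''| ≤ 2 * CPKe * Mf * exp (-(μ * ∑ i, (((b'' i - b₀ i).natAbs : ℕ) : ℝ))) := fun b'' => by
    rw [hmK]; exact hmean b'' _ uK huKd
  have hmd : ∀ b'', |m b''| ≤ 2 * CPKe * Mf * exp (-(μ * ∑ i, (((b'' i - b₀ i).natAbs : ℕ) : ℝ))) := fun b'' => by
    rw [hm]; exact hmean b'' _ u hud
  have hmdiffd : ∀ b'', |mK b'' - m b''| ≤ 4 * CPKe * (CPKe * Y) * Mf * exp (-(μ * ∑ i, (((b'' i - b₀ i).natAbs : ℕ) : ℝ))) :=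
    fun b'' => by rw [hmK, hm]; exact hmdiff b''
  -- response kernels: decay of `h^K_{b″}`, of `h_{b″}`, and their `O(ε)` difference ((223))
  have hS0 : ∀ b' c : X d, (0 : ℝ) ≤ ∑ i, (((b' i - c i).natAbs : ℕ) : ℝ) := fun b' c => by positivity
  have hrKd : ∀ b'', |hrK b'' p| ≤ 2 * CM * (2 * CPK) * Kv * exp (-(ν * ∑ i, (((blk n p i - b'' i).natAbs : ℕ) : ℝ))) := by
    intro b''
    obtain ⟨hcs, hcb⟩ := tsum_exp_conv_noLoss (d := d) hν.le hνμ b'' (blk n p)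
    rw [← hKv] at hcb
    have hdom : ∀ b', |N b' b'' * ΨK b' p| ≤ 2 * CM * (2 * CPK) * (exp (-(μ * ∑ i, (((blk n p i - b' i).natAbs : ℕ) : ℝ)))
        * exp (-(ν * ∑ i, (((b' i - b'' i).natAbs : ℕ) : ℝ)))) := fun b' => by
      rw [abs_mul]
      calc |N b' b''| * |ΨK b' p| ≤ (2 * CM * exp (-(ν * ∑ i, (((b' i - b'' i).natAbs : ℕ) : ℝ))))
            * (2 * CPK * exp (-(μ * ∑ i, (((blk n p i - b' i).natAbs : ℕ) : ℝ)))) :=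
            mul_le_mul (hC1 b' b'') (hA4 b' p) (abs_nonneg _) (by positivity)
        _ = _ := by ring
    have hs : Summable fun b' : X d => N b' b'' * ΨK b' p :=
      Summable.of_norm_bounded (hcs.mul_left _) fun b' => by rw [Real.norm_eq_abs]; exact hdom b'
    rw [hhrK]
    have h1 : |∑' b' : X d, N b' b'' * ΨK b' p| ≤ ∑' b' : X d, |N b' b'' * ΨK b' p| := by
      have := norm_tsum_le_tsum_norm hs.norm; simpa only [Real.norm_eq_abs] using this
    have h2 := hs.abs.tsum_le_tsum hdom (hcs.mul_left _)
    rw [Summable.tsum_mul_left _ hcs] at h2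
    calc _ ≤ 2 * CM * (2 * CPK) * (Kv * exp (-(ν * ∑ i, (((blk n p i - b'' i).natAbs : ℕ) : ℝ)))) :=
        h1.trans (h2.trans (mul_le_mul_of_nonneg_left hcb (by positivity)))
      _ = _ := by ring
  have hrd : ∀ b'', |hr b'' p| ≤ c₁ * (2 * CPK) * Kv * exp (-(ν * ∑ i, (((blk n p i - b'' i).natAbs : ℕ) : ℝ))) := by
    intro b''
    obtain ⟨hcs, hcb⟩ := tsum_exp_conv_noLoss (d := d) hν.le hνμ b'' (blk n p)
    rw [← hKv] at hcb
    have hMν : ∀ b', |M b' b''| ≤ c₁ * exp (-(ν * ∑ i, (((b' i - b'' i).natAbs : ℕ) : ℝ))) := fun b' =>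
      (hB2 b' b'').trans (mul_le_mul_of_nonneg_left (exp_le_exp.2 (neg_le_neg (mul_le_mul_of_nonneg_right hνδ.le (hS0 b' b''))))
        hc₁.le)
    have hdom : ∀ b', |M b' b'' * Ψ b' p| ≤ c₁ * (2 * CPK) * (exp (-(μ * ∑ i, (((blk n p i - b' i).natAbs : ℕ) : ℝ)))
        * exp (-(ν * ∑ i, (((b' i - b'' i).natAbs : ℕ) : ℝ)))) := fun b' => by
      rw [abs_mul]
      calc |M b' b''| * |Ψ b' p| ≤ (c₁ * exp (-(ν * ∑ i, (((b' i - b'' i).natAbs : ℕ) : ℝ))))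
            * (2 * CPK * exp (-(μ * ∑ i, (((blk n p i - b' i).natAbs : ℕ) : ℝ)))) :=
            mul_le_mul (hMν b') (hA2 b' p) (abs_nonneg _) (by positivity)
        _ = _ := by ring
    have hs : Summable fun b' : X d => M b' b'' * Ψ b' p :=
      Summable.of_norm_bounded (hcs.mul_left _) fun b' => by rw [Real.norm_eq_abs]; exact hdom b'
    rw [hhr]
    have h1 : |∑' b' : X d, M b' b'' * Ψ b' p| ≤ ∑' b' : X d, |M b' b'' * Ψ b' p| := by
      have := norm_tsum_le_tsum_norm hs.norm; simpa only [Real.norm_eq_abs] using this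
    have h2 := hs.abs.tsum_le_tsum hdom (hcs.mul_left _)
    rw [Summable.tsum_mul_left _ hcs] at h2
    calc _ ≤ c₁ * (2 * CPK) * (Kv * exp (-(ν * ∑ i, (((blk n p i - b'' i).natAbs : ℕ) : ℝ)))) :=
        h1.trans (h2.trans (mul_le_mul_of_nonneg_left hcb (by positivity)))
      _ = _ := by ring
  have hrdiff : ∀ b'', |hrK b'' p - hr b'' p| ≤ L * Kv * exp (-(ν * ∑ i, (((blk n p i - b'' i).natAbs : ℕ) : ℝ))) :=
    fun b'' => by rw [hhrK, hhr]; exact (hD b'' p).2.2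
  -- the response parts: summability and the `O(ε)` bound on their difference (two no-loss convolutions)
  obtain ⟨hcs, hcb⟩ := tsum_exp_conv_noLoss (d := d) hν.le hνμ (blk n p) b₀
  rw [← hKv, natAbs_sub_comm_sum b₀ (blk n p)] at hcb
  have hdomK : ∀ b'', |mK b'' * hrK b'' p| ≤ 2 * CPKe * Mf * (2 * CM * (2 * CPK) * Kv)
      * (exp (-(μ * ∑ i, (((b₀ i - b'' i).natAbs : ℕ) : ℝ))) * exp (-(ν * ∑ i, (((b'' i - blk n p i).natAbs : ℕ) : ℝ)))) := by
    intro b''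
    rw [abs_mul, natAbs_sub_comm_sum b₀ b'', natAbs_sub_comm_sum b'' (blk n p)]
    calc |mK b''| * |hrK b'' p| ≤ (2 * CPKe * Mf * exp (-(μ * ∑ i, (((b'' i - b₀ i).natAbs : ℕ) : ℝ))))
          * (2 * CM * (2 * CPK) * Kv * exp (-(ν * ∑ i, (((blk n p i - b'' i).natAbs : ℕ) : ℝ)))) :=
          mul_le_mul (hmKd b'') (hrKd b'') (abs_nonneg _) (by positivity)
      _ = _ := by ring
  have hdom0 : ∀ b'', |m b'' * hr b'' p| ≤ 2 * CPKe * Mf * (c₁ * (2 * CPK) * Kv)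
      * (exp (-(μ * ∑ i, (((b₀ i - b'' i).natAbs : ℕ) : ℝ))) * exp (-(ν * ∑ i, (((b'' i - blk n p i).natAbs : ℕ) : ℝ)))) := by
    intro b''
    rw [abs_mul, natAbs_sub_comm_sum b₀ b'', natAbs_sub_comm_sum b'' (blk n p)]
    calc |m b''| * |hr b'' p| ≤ (2 * CPKe * Mf * exp (-(μ * ∑ i, (((b'' i - b₀ i).natAbs : ℕ) : ℝ))))
          * (c₁ * (2 * CPK) * Kv * exp (-(ν * ∑ i, (((blk n p i - b'' i).natAbs : ℕ) : ℝ)))) :=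
          mul_le_mul (hmd b'') (hrd b'') (abs_nonneg _) (by positivity)
      _ = _ := by ring
  have hdomD : ∀ b'', |mK b'' * hrK b'' p - m b'' * hr b'' p|
      ≤ (4 * CPKe * (CPKe * Y) * (2 * CM * (2 * CPK) * Kv) + 2 * CPKe * (L * Kv)) * Mf
        * (exp (-(μ * ∑ i, (((b₀ i - b'' i).natAbs : ℕ) : ℝ))) * exp (-(ν * ∑ i, (((b'' i - blk n p i).natAbs : ℕ) : ℝ)))) := by
    intro b''
    have e : mK b'' * hrK b'' p - m b'' * hr b'' p = (mK b'' - m b'') * hrK b'' p + m b'' * (hrK b'' p - hr b'' p) := by ring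
    rw [e, natAbs_sub_comm_sum b₀ b'', natAbs_sub_comm_sum b'' (blk n p)]
    refine (abs_add_le _ _).trans ?_
    rw [abs_mul, abs_mul]
    calc |mK b'' - m b''| * |hrK b'' p| + |m b''| * |hrK b'' p - hr b'' p|
        ≤ (4 * CPKe * (CPKe * Y) * Mf * exp (-(μ * ∑ i, (((b'' i - b₀ i).natAbs : ℕ) : ℝ))))
            * (2 * CM * (2 * CPK) * Kv * exp (-(ν * ∑ i, (((blk n p i - b'' i).natAbs : ℕ) : ℝ))))
          + (2 * CPKe * Mf * exp (-(μ * ∑ i, (((b'' i - b₀ i).natAbs : ℕ) : ℝ))))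
            * (L * Kv * exp (-(ν * ∑ i, (((blk n p i - b'' i).natAbs : ℕ) : ℝ)))) :=
          add_le_add (mul_le_mul (hmdiffd b'') (hrKd b'') (abs_nonneg _) (by positivity))
            (mul_le_mul (hmd b'') (hrdiff b'') (abs_nonneg _) (by positivity))
      _ = _ := by ring
  have hsK : Summable fun b'' : X d => mK b'' * hrK b'' p :=
    Summable.of_norm_bounded (hcs.mul_left _) fun b'' => by rw [Real.norm_eq_abs]; exact hdomK b''
  have hs0 : Summable fun b'' : X d => m b'' * hr b'' p :=
    Summable.of_norm_bounded (hcs.mul_left _) fun b'' => by rw [Real.norm_eq_abs]; exact hdom0 b''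
  refine ⟨hsK, hs0, ?_⟩
  have hHdiff : |∑' b'' : X d, mK b'' * hrK b'' p - ∑' b'' : X d, m b'' * hr b'' p|
      ≤ (4 * CPKe * (CPKe * Y) * (2 * CM * (2 * CPK) * Kv) + 2 * CPKe * (L * Kv)) * Mf
        * (Kv * exp (-(ν * ∑ i, (((blk n p i - b₀ i).natAbs : ℕ) : ℝ)))) := by
    rw [← hsK.tsum_sub hs0]
    have h1 : |∑' b'' : X d, (mK b'' * hrK b'' p - m b'' * hr b'' p)| ≤ ∑' b'' : X d, |mK b'' * hrK b'' p - m b'' * hr b'' p| := by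
      have := norm_tsum_le_tsum_norm (hsK.sub hs0).norm; simpa only [Real.norm_eq_abs] using this
    have h2 := (hsK.sub hs0).abs.tsum_le_tsum hdomD (hcs.mul_left _)
    rw [Summable.tsum_mul_left _ hcs] at h2
    exact h1.trans (h2.trans (mul_le_mul_of_nonneg_left hcb (by positivity)))
  -- `u^K − u` at rate `ν`
  have hdiffν : |uK p - u p| ≤ 4 * CPKe * (CPKe * Y) * Mf * exp (-(ν * ∑ i, (((blk n p i - b₀ i).natAbs : ℕ) : ℝ))) :=
    (hdiff p).trans (mul_le_mul_of_nonneg_left (exp_le_exp.2 (neg_le_neg (mul_le_mul_of_nonneg_right hνμ.le (hS0 _ _))))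
      (by positivity))
  have e : uK p - ∑' b'' : X d, mK b'' * hrK b'' p - (u p - ∑' b'' : X d, m b'' * hr b'' p)
      = (uK p - u p) - (∑' b'' : X d, mK b'' * hrK b'' p - ∑' b'' : X d, m b'' * hr b'' p) := by ring
  rw [e]
  calc _ ≤ |uK p - u p| + |∑' b'' : X d, mK b'' * hrK b'' p - ∑' b'' : X d, m b'' * hr b'' p| := abs_sub _ _
    _ ≤ 4 * CPKe * (CPKe * Y) * Mf * exp (-(ν * ∑ i, (((blk n p i - b₀ i).natAbs : ℕ) : ℝ)))
        + (4 * CPKe * (CPKe * Y) * (2 * CM * (2 * CPK) * Kv) + 2 * CPKe * (L * Kv)) * Mf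
          * (Kv * exp (-(ν * ∑ i, (((blk n p i - b₀ i).natAbs : ℕ) : ℝ)))) := add_le_add hdiffν hHdiff
    _ = _ := by ring

/-! ## §2. Toy -/

/-- Toy (`d = 3`): the no-loss convolution that carries (E) — rates `1 < 2` on `ℤ³`. -/
example : ∑' c : X 3, exp (-(2 * ∑ i, ((((0 : X 3) i - c i).natAbs : ℕ) : ℝ)))
    * exp (-(1 * ∑ i, (((c i - (0 : X 3) i).natAbs : ℕ) : ℝ)))
    ≤ (2 * (1 - exp (-(2 - 1)))⁻¹) ^ 3 * exp (-(1 * ∑ i, ((((0 : X 3) i - (0 : X 3) i).natAbs : ℕ) : ℝ))) :=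
  (tsum_exp_conv_noLoss (d := 3) zero_le_one one_lt_two 0 0).2

end Summit.QuantumFields.BalabanUV.T4Continuum.NE7b.SupZdPerturbedCovarianceLipschitz
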